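import Summits.NavierStokesRegularity.NavierStokesRegularity.Theorems.ClockStretchingLawClockCeilingOpenSetVorticityLiouville
import Summits.NavierStokesRegularity.NavierStokesRegularity.Theorems.ClockStretchingLawClockCeilingStubTranslationInvariantAfter
import Summits.NavierStokesRegularity.NavierStokesRegularity.Theorems.SymmetryModuliCountSymmetricLiouvilleRotationCovariance
import Summits.NavierStokesRegularity.NavierStokesRegularity.Theorems.ClockStretchingLawClockCeilingZoomScaling
import HarnessLib

/-!
# Route ClockStretchingLaw, crux `ClockCeiling` (stmt-NavierStokesRegularity-10570), line `registered` —
# uniform structural law: GERM RIGIDITY of the Type-I ancient mild class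

`germRigidity`: two elements `u ∈ A_C`, `v ∈ A_{C'}` of the Type-I ancient mild class
(`IsTypeIAncientMild`: jointly smooth on `t < 0`, divergence free, KNSS/Oseen mild between all pairs
`s < t < 0`, `‖u(t,x)‖ ≤ C/√(−t)`) whose slices at ONE time `t₀ < 0` agree on ONE nonempty open set
`U ⊆ ℝ³` coincide on the whole open slab `(−∞, 0) × ℝ³` — forward AND backward in time. A class
element is determined by any one of its space–time germs.

Consequences recorded here (all elements, all times; no "singular"/"nonzero" hypothesis):

* `translationInvariant_of_germ`, `isometryInvariant_of_germ` — a Euclidean symmetry visible on a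
  germ of one slice is an EXACT symmetry of the element at ALL times (upgrades the forward-only,
  whole-slice `stub_translationInvariantAfter`, p167497, in both respects);
* `dss_of_germ` — if a parabolic zoom `nsRescale c u` matches `u` on a germ of one slice, `u` is
  backward discretely self-similar with factor `c` at all times;
* `eq_zero_of_germ_timeRecurrent` — **no breathing without rescaling**: if a germ of the slice at
  time `t₀ − δ` (`δ > 0`) reappears at the same place at time `t₀`, then `u ≡ 0` (the element is
  then `δ`-periodic in time on `(−∞,0)`, and the Type-I bound `C/√(nδ − t) → 0` kills it). For a
  nonzero element the curve `t ↦ (germ of u(t) at any fixed region)` is injective.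

## Proof of `germRigidity`

1. *Analyticity.* `uncurry u`, `uncurry v` are jointly real-analytic on `(−∞,0) × ℝ³`
   (`openSetLiouville_analyticOnNhd_uncurry`: Lemarié-Rieusset 2016 Thm. 9.12 + uniqueness of
   bounded Oseen-mild solutions), hence so is `w = u − v`, its slice `w(t₀, ·)` and every time
   curve `s ↦ w(s, x)`.
2. *Identity theorem in space.* `w(t₀, ·)` vanishes near a point of `U`, hence on the connected
   `ℝ³`: the two slices at time `t₀` agree everywhere.
3. *Forward.* On every slab `(t₀, t/2) × ℝ³` both fields are bounded, jointly measurable solutions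
   of the SAME Oseen integral equation from the common datum at `t₀` (`eq_after_of_slice_eq`,
   uniqueness of bounded Oseen-mild solutions, KNSS 2009 §4 = `oseenMild_bounded_unique`).
4. *Backward.* Each analytic time curve `s ↦ w(s, x)` vanishes on the open `(t₀, 0)`, hence on the
   connected `(−∞, 0)` (identity theorem).

## References

* G. Koch, N. Nadirashvili, G. Seregin, V. Šverák, *Liouville theorems for the Navier–Stokes
  equations and applications*, Acta Math. 203 (2009) 83–105 = arXiv:0709.3599, §1 p. 3 (symmetries
  of the class), §4 (4.3)–(4.4) (uniqueness of bounded mild solutions). [KochNadirashviliSereginSverak2009]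
* P. G. Lemarié-Rieusset, *The Navier–Stokes Problem in the 21st Century*, CRC Press 2016,
  Thm. 9.12 (space–time analyticity of bounded mild solutions). [LemarieRieusset2016]
-/

noncomputable section

-- the summit and its single sub-problem share the name (CONVENTIONS §1), as in every Theorems file
set_option linter.dupNamespace false

namespace Summit.NavierStokesRegularity.NavierStokesRegularity.Theorems

open MeasureTheory Set Function Filter Topology
open Literature.Analysis Literature.Analysis.FluidPDE

section GermRigidity

variable {C C' : ℝ} {u v : ℝ → EuclideanSpace ℝ (Fin 3) → EuclideanSpace ℝ (Fin 3)}

/-- **Forward uniqueness inside the class**: two Type-I ancient mild fields (possibly with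
different constants) with the same slice at time `s` agree at every later time `s < t < 0` — on
the slab `(s, t/2) × ℝ³` both are bounded by `max(C, C')/√(−t/2)`, jointly measurable, and solve the
same Oseen integral equation with the common free term `e^{(τ−s)Δ}u(s)`, so they agree a.e.
(`oseenMild_bounded_unique`), hence everywhere by continuity of the slices.
[cite: KochNadirashviliSereginSverak2009, §4 (4.3)–(4.4) (arXiv:0709.3599 p. 8)] -/
theorem eq_after_of_slice_eq (hu : IsTypeIAncientMild C u) (hv : IsTypeIAncientMild C' v)
    {s : ℝ} (heq : ∀ x, u s x = v s x) {t : ℝ} (hst : s < t) (ht : t < 0)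
    (x : EuclideanSpace ℝ (Fin 3)) : u t x = v t x := by
  have hT'0 : t / 2 < 0 := by linarith
  have htI : t ∈ Ioo s (t / 2) := ⟨hst, by linarith⟩
  set M : ℝ := max (C / Real.sqrt (-(t / 2))) (C' / Real.sqrt (-(t / 2))) with hMdef
  have hM : 0 ≤ M := le_max_of_le_left (div_nonneg hu.nonneg (Real.sqrt_nonneg _))
  have huM : ∀ τ ∈ Ioo s (t / 2), ∀ y, ‖u τ y‖ ≤ M := fun τ hτ y =>
    (hu.norm_le_of_mem_Ioo hT'0 hτ y).trans (le_max_left _ _)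
  have hvM : ∀ τ ∈ Ioo s (t / 2), ∀ y, ‖v τ y‖ ≤ M := fun τ hτ y =>
    (hv.norm_le_of_mem_Ioo hT'0 hτ y).trans (le_max_right _ _)
  have hum := hu.aestronglyMeasurable_uncurry (s := s) hT'0.le
  have hvm := hv.aestronglyMeasurable_uncurry (s := s) hT'0.le
  have hsv : v s = u s := funext fun y => (heq y).symm
  -- the two integral equations with the common free term `e^{(τ-s)Δ} u(s)`
  have hu' : ∀ τ ∈ Ioo s (t / 2), u τ =ᵐ[volume] fun y =>
      UnboundedOperators.heatExtension (u s) (τ - s) y - oseenDuhamel 1 s u u τ y :=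
    fun τ hτ => Eventually.of_forall fun y => hu.mild_eq_heatExtension hτ.1 (hτ.2.trans hT'0) y
  have hv' : ∀ τ ∈ Ioo s (t / 2), v τ =ᵐ[volume] fun y =>
      UnboundedOperators.heatExtension (u s) (τ - s) y - oseenDuhamel 1 s v v τ y := by
    intro τ hτ
    refine Eventually.of_forall fun y => ?_
    rw [← hsv]
    exact hv.mild_eq_heatExtension hτ.1 (hτ.2.trans hT'0) y
  have key := oseenMild_bounded_unique one_pos hM hum hvm huM hvM hu' hv' t htI
  have heq' := (Continuous.ae_eq_iff_eq volume (hu.continuous_slice ht) (hv.continuous_slice ht)).1 key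
  exact congr_fun heq' x

/-- **GERM RIGIDITY of the Type-I ancient mild class**: if `u ∈ A_C` and `v ∈ A_{C'}` have slices
at ONE time `t₀ < 0` that agree on ONE nonempty open set `U ⊆ ℝ³`, then `u = v` on the whole open
slab `t < 0`. Joint real-analyticity (`openSetLiouville_analyticOnNhd_uncurry`) + identity theorem
on the slice + forward uniqueness (`eq_after_of_slice_eq`) + identity theorem along the analytic
time curves `s ↦ u(s,x) − v(s,x)`, which vanish on the open `(t₀, 0)`.
[cite: LemarieRieusset2016, Thm. 9.12 (PDF p. 260)] -/
theorem germRigidity (hu : IsTypeIAncientMild C u) (hv : IsTypeIAncientMild C' v) {t₀ : ℝ}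
    (ht₀ : t₀ < 0) {U : Set (EuclideanSpace ℝ (Fin 3))} (hU : IsOpen U) (hne : U.Nonempty)
    (heq : ∀ x ∈ U, u t₀ x = v t₀ x) {t : ℝ} (ht : t < 0) (x : EuclideanSpace ℝ (Fin 3)) :
    u t x = v t x := by
  -- the difference field is jointly analytic
  set w : ℝ → EuclideanSpace ℝ (Fin 3) → EuclideanSpace ℝ (Fin 3) := fun s y => u s y - v s y
    with hw
  have hanw : AnalyticOnNhd ℝ (uncurry w) (Iio 0 ×ˢ (univ : Set (EuclideanSpace ℝ (Fin 3)))) := by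
    have e : uncurry w = uncurry u - uncurry v := by
      funext p
      rfl
    rw [e]
    exact (openSetLiouville_analyticOnNhd_uncurry hu).sub (openSetLiouville_analyticOnNhd_uncurry hv)
  -- step 1: the slices at time `t₀` agree everywhere
  obtain ⟨x₀, hx₀⟩ := hne
  have hslice : AnalyticOnNhd ℝ (w t₀) univ := analyticOnNhd_slice hanw ht₀
  have hev : w t₀ =ᶠ[𝓝 x₀] 0 :=
    Filter.eventually_of_mem (hU.mem_nhds hx₀) fun y hy => sub_eq_zero.2 (heq y hy)
  have hzero := hslice.eqOn_zero_of_preconnected_of_eventuallyEq_zero isPreconnected_univ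
    (mem_univ x₀) hev
  have hs0 : ∀ y, u t₀ y = v t₀ y := fun y => sub_eq_zero.1 (hzero (mem_univ y))
  -- step 2: forward in time
  have hfwd : ∀ s ∈ Ioo t₀ 0, ∀ y, u s y = v s y := fun s hs y =>
    eq_after_of_slice_eq hu hv hs0 hs.1 hs.2 y
  -- step 3: backward in time along the analytic time curve through `x`
  have hG : AnalyticOnNhd ℝ (fun s => w s x) (Iio 0) := fun s hs =>
    (hanw (s, x) (mk_mem_prod hs (mem_univ _))).curry_left
  have heqc : (fun s => w s x) =ᶠ[𝓝 (t₀ / 2)] 0 := by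
    have hmem : Ioo t₀ 0 ∈ 𝓝 (t₀ / 2) := Ioo_mem_nhds (by linarith) (by linarith)
    filter_upwards [hmem] with s hs using sub_eq_zero.2 (hfwd s hs x)
  have hz₀ : t₀ / 2 ∈ Iio (0 : ℝ) := by
    show t₀ / 2 < 0
    linarith
  have h := hG.eqOn_zero_of_preconnected_of_eventuallyEq_zero isPreconnected_Iio hz₀ heqc ht
  exact sub_eq_zero.1 h

/-- **A translation symmetry seen on a germ is exact at all times**: if `u ∈ A_C` and
`u(t₀, x + b) = u(t₀, x)` for `x` in a nonempty open `U` (one `t₀ < 0`), then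
`u(t, x + b) = u(t, x)` for ALL `t < 0` and all `x` (`germRigidity` against the translate
`(t, x) ↦ u(t, x + b) ∈ A_C`, `translationInvariantAfter_isTypeIAncientMild_comp_add_right`).
[cite: KochNadirashviliSereginSverak2009, §1 p. 3 (arXiv:0709.3599)] -/
theorem translationInvariant_of_germ (hu : IsTypeIAncientMild C u) {t₀ : ℝ} (ht₀ : t₀ < 0)
    {U : Set (EuclideanSpace ℝ (Fin 3))} (hU : IsOpen U) (hne : U.Nonempty)
    (b : EuclideanSpace ℝ (Fin 3)) (heq : ∀ x ∈ U, u t₀ (x + b) = u t₀ x) {t : ℝ} (ht : t < 0)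
    (x : EuclideanSpace ℝ (Fin 3)) : u t (x + b) = u t x :=
  germRigidity (u := fun s y => u s (y + b))
    (translationInvariantAfter_isTypeIAncientMild_comp_add_right hu b) hu ht₀ hU hne heq ht x

/-- **An isometric symmetry seen on a germ is exact at all times**: for a linear isometry `L` of
`ℝ³`, if `L (u(t₀, L⁻¹x)) = u(t₀, x)` for `x` in a nonempty open `U` (one `t₀ < 0`), then
`L (u(t, L⁻¹x)) = u(t, x)` for ALL `t < 0` and all `x` (`germRigidity` against the conjugate
`(t, x) ↦ L (u(t, L⁻¹x)) ∈ A_C`, `isTypeIAncientMild_conj_linearIsometryEquiv`).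
[cite: KochNadirashviliSereginSverak2009, §1 p. 3 (arXiv:0709.3599)] -/
theorem isometryInvariant_of_germ (hu : IsTypeIAncientMild C u)
    (L : EuclideanSpace ℝ (Fin 3) ≃ₗᵢ[ℝ] EuclideanSpace ℝ (Fin 3)) {t₀ : ℝ} (ht₀ : t₀ < 0)
    {U : Set (EuclideanSpace ℝ (Fin 3))} (hU : IsOpen U) (hne : U.Nonempty)
    (heq : ∀ x ∈ U, L (u t₀ (L.symm x)) = u t₀ x) {t : ℝ} (ht : t < 0)
    (x : EuclideanSpace ℝ (Fin 3)) : L (u t (L.symm x)) = u t x :=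
  germRigidity (u := fun s y => L (u s (L.symm y)))
    (SymmetryModuliCountSymmetricLiouville.isTypeIAncientMild_conj_linearIsometryEquiv hu L)
    hu ht₀ hU hne heq ht x

/-- **A scaling recurrence seen on a germ makes the element backward DSS**: if the parabolic zoom
`nsRescale c u` (`c > 0`) agrees with `u` on a germ of ONE slice, then `nsRescale c u = u` on the
whole slab `t < 0` (`germRigidity` against the zoom, `zoom_isTypeIAncientMild`).
[cite: KochNadirashviliSereginSverak2009, §1 (1.2) (arXiv:0709.3599)] -/
theorem dss_of_germ (hu : IsTypeIAncientMild C u) {c : ℝ} (hc : 0 < c) {t₀ : ℝ} (ht₀ : t₀ < 0)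
    {U : Set (EuclideanSpace ℝ (Fin 3))} (hU : IsOpen U) (hne : U.Nonempty)
    (heq : ∀ x ∈ U, nsRescale c u t₀ x = u t₀ x) {t : ℝ} (ht : t < 0)
    (x : EuclideanSpace ℝ (Fin 3)) : nsRescale c u t x = u t x :=
  germRigidity (zoom_isTypeIAncientMild hu hc) hu ht₀ hU hne heq ht x

/-- **A time recurrence seen on a germ propagates: the element is time periodic** — if
`u(t₀ − δ, x) = u(t₀, x)` for `x` in a nonempty open `U` (`0 ≤ δ`, one `t₀ < 0`), then
`u(t − δ, x) = u(t, x)` for ALL `t < 0` and all `x` (`germRigidity` against the time translate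
`t ↦ u(t − δ) ∈ A_C`, `IsTypeIAncientMild.comp_sub_right`).
[cite: KochNadirashviliSereginSverak2009, §1 p. 3 (arXiv:0709.3599)] -/
theorem timePeriodic_of_germ (hu : IsTypeIAncientMild C u) {δ : ℝ} (hδ : 0 ≤ δ) {t₀ : ℝ}
    (ht₀ : t₀ < 0) {U : Set (EuclideanSpace ℝ (Fin 3))} (hU : IsOpen U) (hne : U.Nonempty)
    (heq : ∀ x ∈ U, u (t₀ - δ) x = u t₀ x) {t : ℝ} (ht : t < 0) (x : EuclideanSpace ℝ (Fin 3)) :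
    u (t - δ) x = u t x :=
  germRigidity (u := fun s y => u (s - δ) y) (hu.comp_sub_right hδ) hu ht₀ hU hne heq ht x

/-- **No breathing without rescaling**: if a germ of the slice of `u ∈ A_C` at time `t₀ − δ`
(`δ > 0`) reappears AT THE SAME PLACE at time `t₀` — `u(t₀ − δ, x) = u(t₀, x)` on a nonempty open
`U` — then `u ≡ 0` on `t < 0`: the element is `δ`-periodic in time (`timePeriodic_of_germ`), so
`‖u(t, x)‖ = ‖u(t − nδ, x)‖ ≤ C/√(nδ − t)` for every `n`, which tends to `0`.
[cite: KochNadirashviliSereginSverak2009, §1 p. 3 and (1.4) (arXiv:0709.3599)] -/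
theorem eq_zero_of_germ_timeRecurrent (hu : IsTypeIAncientMild C u) {δ : ℝ} (hδ : 0 < δ) {t₀ : ℝ}
    (ht₀ : t₀ < 0) {U : Set (EuclideanSpace ℝ (Fin 3))} (hU : IsOpen U) (hne : U.Nonempty)
    (heq : ∀ x ∈ U, u (t₀ - δ) x = u t₀ x) : ∀ t < 0, ∀ x, u t x = 0 := by
  intro t ht x
  -- periodicity, iterated
  have hiter : ∀ n : ℕ, u (t - n * δ) x = u t x := by
    intro n
    induction n with
    | zero => simp
    | succ n ih =>
      have hn0 : (0 : ℝ) ≤ n * δ := by positivity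
      have e : t - ((n + 1 : ℕ) : ℝ) * δ = (t - n * δ) - δ := by
        push_cast
        ring
      rw [e, timePeriodic_of_germ hu hδ.le ht₀ hU hne heq (by linarith) x]
      exact ih
  -- the Type-I bound along the orbit
  by_contra hx
  have ha : 0 < ‖u t x‖ := norm_pos_iff.2 hx
  obtain ⟨n, hn⟩ := exists_nat_gt ((C / ‖u t x‖) ^ 2 / δ)
  have hn0 : (0 : ℝ) ≤ n * δ := by positivity
  have htn : t - n * δ < 0 := by linarith
  have key := hu.norm_le htn x
  rw [hiter n] at key
  -- `(C/a)² < nδ - t`, so `√(nδ - t) > C/a` and `a √(nδ - t) > C ≥ a √(nδ - t)`: absurd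
  have hR : (C / ‖u t x‖) ^ 2 < -(t - n * δ) := by
    have h1 : (C / ‖u t x‖) ^ 2 < n * δ := (div_lt_iff₀ hδ).1 hn
    linarith
  have hsqrt : C / ‖u t x‖ < Real.sqrt (-(t - n * δ)) := by
    rw [show C / ‖u t x‖ = Real.sqrt ((C / ‖u t x‖) ^ 2) from
      (Real.sqrt_sq (div_nonneg hu.nonneg ha.le)).symm]
    exact Real.sqrt_lt_sqrt (sq_nonneg _) hR
  have hRpos : 0 < Real.sqrt (-(t - n * δ)) :=
    lt_of_le_of_lt (div_nonneg hu.nonneg ha.le) hsqrt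
  have h1 : ‖u t x‖ * Real.sqrt (-(t - n * δ)) ≤ C := (le_div_iff₀ hRpos).1 key
  have h2 : C < ‖u t x‖ * Real.sqrt (-(t - n * δ)) := by
    have h3 := mul_lt_mul_of_pos_left hsqrt ha
    rwa [mul_div_assoc', mul_div_cancel_left₀ C ha.ne'] at h3
  linarith

end GermRigidity

/-- **Stub `stub_germRigidity` (crux stmt-NavierStokesRegularity-10570, line `registered`, uniform
structural law)**: GERM RIGIDITY of the Type-I ancient mild class — two elements (constants `C`,
`C'`) whose slices at one time `t₀ < 0` agree on one nonempty open set of `ℝ³` coincide on the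
whole slab `t < 0` (joint real-analyticity + identity theorem + forward uniqueness of bounded
Oseen-mild solutions + time analyticity; `germRigidity`).
[cite: LemarieRieusset2016, Thm. 9.12 (PDF p. 260)] -/
theorem stub_germRigidity : ∀ (C C' : ℝ) (u v : ℝ → EuclideanSpace ℝ (Fin 3) → EuclideanSpace ℝ (Fin 3)), Literature.Analysis.FluidPDE.IsTypeIAncientMild C u → Literature.Analysis.FluidPDE.IsTypeIAncientMild C' v → ∀ (t₀ : ℝ) (U : Set (EuclideanSpace ℝ (Fin 3))), t₀ < 0 → IsOpen U → U.Nonempty → (∀ x ∈ U, u t₀ x = v t₀ x) → ∀ t < 0, ∀ x, u t x = v t x :=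
  fun _ _ _ _ hu hv _ _ ht₀ hU hne heq _ ht x => germRigidity hu hv ht₀ hU hne heq ht x

/-- **Stub `stub_germTimeRecurrenceLiouville` (crux stmt-NavierStokesRegularity-10570, line
`registered`, sub-class Liouville)**: NO BREATHING WITHOUT RESCALING — an element of the Type-I
ancient mild class one of whose spatial germs recurs at the same place after a time lag `δ > 0`
(`u(t₀ − δ, ·) = u(t₀, ·)` on a nonempty open set) vanishes identically (`eq_zero_of_germ_timeRecurrent`).
[cite: KochNadirashviliSereginSverak2009, §1 p. 3 and (1.4) (arXiv:0709.3599)] -/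
theorem stub_germTimeRecurrenceLiouville : ∀ (C : ℝ) (u : ℝ → EuclideanSpace ℝ (Fin 3) → EuclideanSpace ℝ (Fin 3)), Literature.Analysis.FluidPDE.IsTypeIAncientMild C u → ∀ (δ t₀ : ℝ) (U : Set (EuclideanSpace ℝ (Fin 3))), 0 < δ → t₀ < 0 → IsOpen U → U.Nonempty → (∀ x ∈ U, u (t₀ - δ) x = u t₀ x) → ∀ t < 0, ∀ x, u t x = 0 :=
  fun _ _ hu _ _ _ hδ ht₀ hU hne heq => eq_zero_of_germ_timeRecurrent hu hδ ht₀ hU hne heq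

end Summit.NavierStokesRegularity.NavierStokesRegularity.Theorems

end
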